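import Literature.Computability.Cryptography.ChenQuantumLWEChirpBasis
import Literature.Computability.Cryptography.ChenQuantumLWEParameterRegime

/-!
# At Chen's sizes the direction class mod `Q` is the secret (T28: census §27.5 (i)–(ii), §36)

REPRODUCTION / ANALYSIS OF A CLAIMED RESULT UNDER ADJUDICATION (withdrawn): Yilei Chen, *Quantum
Algorithms for Lattice Problems*, IACR ePrint 2024/555, version of 2024-04-18 [ChenQuantumLattice2024]
(the version carrying the author's note that Step 9 contains a bug), Step 9 (§3.5.9, pp. 34–38) acting
on the line kets `|φ_{b,v′}⟩ = Σ_{j ∈ ℤ_P} ψ_P(−j²) |2D²j·b + v′ mod N⟩` (p. 35) of the planted vector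
`b = [−1, 2p₁(…)ᵀ]ᵀ` of eq. (12) (p. 17), `P = p₁Q`, `N = D²P`; §3.3 "Parameters and conditions"
(pp. 18–20): Cond. **C.1** `t/u = √c > 64 log³n`, Cond. **C.2** `u = D‖b‖`, `M = 2(t² + u²)`,
Cond. **C.3** `M/(2D²) = (c+1)‖b‖² = p₁p₂⋯p_κ =: N = p₁Q`; **Lemma 3.6 (3)** (p. 17)
`‖b‖² ∈ 1 + 4p₁²(p₂² + … + p_κ²) + [0.04, 0.27]·4p₁²β²(n − κ)`, `β ≥ 2`, `κ ∈ O(log n)`.  Bundle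
`papers/QuantumAdvantage/lwe-quantum-autopsy/`, Part 2 (`REPAIR-CENSUS.md` §27.5 (i)–(ii) — hitherto BY
HAND — and §36; theorem **T28**; census row G7), sequel of `ChenQuantumLWEChirpBasis.lean` (T18 (4):
the datum reader of `b` is datum-certain on all line kets of `b′` iff `b ≡ b′ (mod Q)` coordinatewise,
and no measurement is datum-certain on the line kets of two directions in different classes mod `Q`)
and of `ChenQuantumLWEParameterRegime.lean` (T27: the printed conditions as real hypotheses).  HONEST
FRAMING: kernel-checked THEOREMS about measurements of states occurring in a WITHDRAWN algorithm plus
elementary real arithmetic on TRANSCRIPTIONS of the printed parameter conditions (each hypothesis named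
after the condition it transcribes) — NOT summit progress, no cryptanalytic claim in either direction,
no new algorithm, no hardness claim; quantum lower bounds are out of scope.

## What is proved

**1. Short integers are their residues** (private helpers `eq_of_intCast_eq`,
`eq_of_forall_intCast_eq`, `exists_intCast_ne_of_ne`).  Two integers `x, y` with `2|x| < m`, `2|y| < m`
and `x ≡ y (mod m)` are equal; coordinatewise for vectors; contrapositively two distinct such vectors
differ mod `m` at some coordinate.

**2. At Chen's sizes every planted-shape vector is short mod `Q`** (`two_mul_norm_lt_of_conditions`,
`two_mul_natAbs_lt_of_conditions`; census §27.5 (i), by hand there).  From C.1 (with `log n ≥ 1`),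
C.2, C.3 for the instance's planted vector `b` and Lemma 3.6 (3) for `b` AND for any vector `b′` of the
same planted shape (same `p₁, p₂, …, p_κ, β, κ, n`; its own `θ′ ∈ [0.04, 0.27]`):
`2‖b′‖₂ < Q`, hence `2|b′_i| < Q` for every coordinate (in particular for `b′ = b`).  Arithmetic:
`Q = N/p₁ = (t² + u²)/(D²p₁) > 4097‖b‖²/p₁` (C.1–C.3), `‖b′‖² ≤ 6.75‖b‖²` and `‖b‖² ≥ 1 + 0.32p₁²`
(Lemma 3.6 (3) with `n + 1 − κ ≥ (n+1)/2`), so `2p₁‖b′‖ ≤ √27·p₁‖b‖ < 10‖b‖² < 4097‖b‖²`.  The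
hypothesis list is satisfiable (`classIsSecret_hypotheses_satisfiable`, from T27's toy witness).

**3. The equality forms of T18 (4)** (`datumReader_certain_iff_eq`, `eq_of_certain_both`; census
§27.5 (ii)).  For head-`(−1)` directions `b, b′` with all coordinates `2|·| < Q` (and `2D²p₁` a unit
mod `Q`, `P` odd, as in T18): the datum reader of `b` is datum-certain on every line ket of `b′`
**iff `b = b′`**; and if ANY measurement `E` is datum-certain on all line kets of `b` and on all line
kets of `b′`, then **`b = b′`** — a datum-certain Step-9 measurement determines the direction it was
built for, i.e. (item 2) at Chen's sizes the planted vector `b` of eq. (12), i.e. the LWE secret and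
error, outright (`eq_of_certain_both_of_conditions` assembles items 2 and 3 from the printed conditions;
`Shape.datumReader_certain_iff_eq`, `Shape.eq_of_certain_both` for admissible shapes).  This closes the
gap between "the class of `b` mod `Q`" (T18) and "`b`" that §27.5 (i) of the census bridged by hand:
the instance-aware repair of census row G7 is circular AT THE SECRET, not merely at its class.

## What is NOT here

Near-certain (approximate) readers and their sample complexity; the success profile `gcd(Q, b − b′)/Q`
of the `b`-reader on a foreign class (by hand, census §27); any statement about the complexity of
building a datum-certain measurement from the instance `(U, t)` (by item 3 such a measurement names
`b`; no claim in either direction is made); Cond. C.4–C.7 (not needed here; see T27).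
-/

namespace Literature.Computability.Cryptography.Chen2024

open scoped BigOperators

/-! ### 1. Short integers are determined by their residues -/

/-- Two integers of absolute value `< m/2` that are congruent mod `m` are equal. [folklore] -/
private theorem eq_of_intCast_eq {m : ℕ} {x y : ℤ} (hx : 2 * x.natAbs < m) (hy : 2 * y.natAbs < m)
    (h : (x : ZMod m) = (y : ZMod m)) : x = y := by
  have hdvd : (m : ℤ) ∣ y - x := (ZMod.intCast_eq_intCast_iff_dvd_sub x y m).1 h
  have hlt : (y - x).natAbs < (m : ℤ).natAbs := by
    rw [Int.natAbs_natCast]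
    exact lt_of_le_of_lt (Int.natAbs_sub_le y x) (by omega)
  have h0 := Int.eq_zero_of_dvd_of_natAbs_lt_natAbs hdvd hlt
  omega

/-- Coordinatewise: two integer vectors with all entries of absolute value `< m/2`, congruent mod `m`
coordinatewise, are equal. [folklore] -/
private theorem eq_of_forall_intCast_eq {ι : Type*} {m : ℕ} {x y : ι → ℤ} (hx : ∀ i, 2 * (x i).natAbs < m)
    (hy : ∀ i, 2 * (y i).natAbs < m) (h : ∀ i, ((x i : ℤ) : ZMod m) = ((y i : ℤ) : ZMod m)) :
    x = y :=
  funext fun i => eq_of_intCast_eq (hx i) (hy i) (h i)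

/-- Contrapositive with a witness: two distinct short vectors differ mod `m` at some coordinate.
[folklore] -/
private theorem exists_intCast_ne_of_ne {ι : Type*} {m : ℕ} {x y : ι → ℤ} (hx : ∀ i, 2 * (x i).natAbs < m)
    (hy : ∀ i, 2 * (y i).natAbs < m) (hne : x ≠ y) :
    ∃ i, ((x i : ℤ) : ZMod m) ≠ ((y i : ℤ) : ZMod m) := by
  obtain ⟨i, hi⟩ := Function.ne_iff.1 hne
  exact ⟨i, fun h => hi (eq_of_intCast_eq (hx i) (hy i) h)⟩

/-! ### 2. Chen's conditions C.1–C.3 and Lemma 3.6 (3): planted-shape vectors are short mod `Q` -/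

section Sizes

/-- **§27.5 (i) of the census, real form.**  With `L = log n ≥ 1`, `D > 0`, `u > 0`, `p₁ > 0`:
C.1 (`t/u > 64L³`), C.2 (`u = D‖b‖`, `M = 2(t² + u²)`), C.3 (`M/(2D²) = N = p₁Q`) for the planted
vector (`‖b‖ = normb`), and Lemma 3.6 (3) for `‖b‖` and for the norm `normb′` of any vector of the same
planted shape (`S₂ = p₂² + … + p_κ² ≥ 0`, `β ≥ 2`, `2κ ≤ n + 1`, own `θ, θ′ ∈ [0.04, 0.27]`) give
`2·normb′ < Q`.  Proof: `QD²p₁ = ND² = t² + u² > 4097u² = 4097D²‖b‖²`, `normb′² ≤ 6.75‖b‖²`,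
`‖b‖² ≥ 1 + 0.32p₁²`, hence `(2p₁normb′)² ≤ 27p₁²‖b‖² ≤ 84.375‖b‖⁴ < (4097‖b‖²)²`.
[cite: ChenQuantumLattice2024, §3.3 pp. 18–20 (Cond. C.1, C.2, C.3), Lemma 3.6 p. 17, eq. (12) p. 17; census §27.5 (i), §36] -/
theorem two_mul_norm_lt_of_conditions {n : ℕ} {L D u t M N p₁ Q S₂ β κ normb normb' : ℝ}
    (hL : 1 ≤ L) (hD : 0 < D) (hu : 0 < u) (hp : 0 < p₁) (hβ : 2 ≤ β) (hS₂ : 0 ≤ S₂)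
    (hκ : 2 * κ ≤ (n + 1 : ℝ)) (hnormb' : 0 ≤ normb')
    (hC1 : 64 * L ^ 3 < t / u) (hC2u : u = D * normb) (hC2M : M = 2 * (t ^ 2 + u ^ 2))
    (hC3 : M / (2 * D ^ 2) = N) (hC3' : N = p₁ * Q)
    (h36 : ∃ θ : ℝ, 0.04 ≤ θ ∧ θ ≤ 0.27 ∧
      normb ^ 2 = 1 + 4 * p₁ ^ 2 * S₂ + θ * (4 * p₁ ^ 2 * β ^ 2 * ((n + 1 : ℝ) - κ)))
    (h36' : ∃ θ' : ℝ, 0.04 ≤ θ' ∧ θ' ≤ 0.27 ∧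
      normb' ^ 2 = 1 + 4 * p₁ ^ 2 * S₂ + θ' * (4 * p₁ ^ 2 * β ^ 2 * ((n + 1 : ℝ) - κ))) :
    2 * normb' < Q := by
  obtain ⟨θ, hθ, -, hsq⟩ := h36
  obtain ⟨θ', -, hθ', hsq'⟩ := h36'
  have hn : (0 : ℝ) ≤ (n : ℝ) := Nat.cast_nonneg n
  have hnk : (1 : ℝ) / 2 ≤ (n + 1 : ℝ) - κ := by linarith
  have hβ2 : 4 ≤ β ^ 2 := by nlinarith
  -- Lemma 3.6 (3): `‖b‖² ≥ 1 + 0.32p₁²` and `normb′² ≤ 6.75‖b‖²`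
  have hX0 : 0 ≤ 4 * p₁ ^ 2 * β ^ 2 * ((n + 1 : ℝ) - κ) := mul_nonneg (by positivity) (by linarith)
  have hθX : 0.04 * (4 * p₁ ^ 2 * β ^ 2 * ((n + 1 : ℝ) - κ))
      ≤ θ * (4 * p₁ ^ 2 * β ^ 2 * ((n + 1 : ℝ) - κ)) := mul_le_mul_of_nonneg_right hθ hX0
  have hθ'X : θ' * (4 * p₁ ^ 2 * β ^ 2 * ((n + 1 : ℝ) - κ))
      ≤ 0.27 * (4 * p₁ ^ 2 * β ^ 2 * ((n + 1 : ℝ) - κ)) := mul_le_mul_of_nonneg_right hθ' hX0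
  have hβX : 0 ≤ p₁ ^ 2 * (β ^ 2 - 4) * ((n + 1 : ℝ) - κ) :=
    mul_nonneg (mul_nonneg (sq_nonneg _) (by linarith)) (by linarith)
  have hkX : 0 ≤ p₁ ^ 2 * (((n + 1 : ℝ) - κ) - 1 / 2) := mul_nonneg (sq_nonneg _) (by linarith)
  have hS : 0 ≤ 4 * p₁ ^ 2 * S₂ := by positivity
  have hlow : 1 + 0.32 * p₁ ^ 2 ≤ normb ^ 2 := by rw [hsq]; linarith
  have hcmp : normb' ^ 2 ≤ 6.75 * normb ^ 2 := by rw [hsq, hsq']; linarith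
  -- C.1 with `L ≥ 1`: `t > 64u`; C.2, C.3: `N·D² = t² + u²`
  have hL3 : 1 ≤ L ^ 3 := one_le_pow₀ hL
  have h64 : (64 : ℝ) < t / u := lt_of_le_of_lt (by linarith) hC1
  have ht : 64 * u < t := (lt_div_iff₀ hu).1 h64
  have hD2 : 0 < D ^ 2 := by positivity
  have hND : N * D ^ 2 = t ^ 2 + u ^ 2 := by
    rw [← hC3, hC2M]; field_simp
  have hu2 : u ^ 2 = D ^ 2 * normb ^ 2 := by rw [hC2u]; ring
  have h1 : 4097 * (D ^ 2 * normb ^ 2) < N * D ^ 2 := by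
    rw [hND]; linarith [mul_self_lt_mul_self (by positivity : (0 : ℝ) ≤ 64 * u) ht, hu2]
  -- `2p₁·normb′ ≤ 4097‖b‖²`
  have h2sq : (2 * normb' * p₁) ^ 2 ≤ (4097 * normb ^ 2) ^ 2 := by
    have hlow' : 0.32 * p₁ ^ 2 ≤ normb ^ 2 := by linarith
    have hA : normb' ^ 2 * p₁ ^ 2 ≤ 6.75 * normb ^ 2 * p₁ ^ 2 :=
      mul_le_mul_of_nonneg_right hcmp (sq_nonneg p₁)
    have hB : normb ^ 2 * (0.32 * p₁ ^ 2) ≤ normb ^ 2 * normb ^ 2 :=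
      mul_le_mul_of_nonneg_left hlow' (sq_nonneg normb)
    have hC : 0 ≤ normb ^ 2 * normb ^ 2 := mul_nonneg (sq_nonneg _) (sq_nonneg _)
    linarith [hA, hB, hC]
  have h2 : 2 * normb' * p₁ ≤ 4097 * normb ^ 2 :=
    (sq_le_sq₀ (by positivity) (by positivity)).1 h2sq
  have h3 : 2 * normb' * p₁ * D ^ 2 < N * D ^ 2 := by
    have := mul_le_mul_of_nonneg_right h2 hD2.le
    linarith [h1, this]
  have h4 : 2 * normb' * p₁ < N := lt_of_mul_lt_mul_right h3 hD2.le
  have h5 : p₁ * (2 * normb') < p₁ * Q := by rw [← hC3']; linarith [h4]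
  exact lt_of_mul_lt_mul_left h5 hp.le

/-- **§27.5 (i) of the census, integer form: at Chen's sizes `b′ mod Q` is `b′`.**  Under the same
transcribed conditions (C.1–C.3 for the instance's planted vector `b` on `n + 1` coordinates,
`‖b‖₂ = √(Σ b_i²)`, `Q` a positive natural with `N = p₁Q`) every integer vector `b′` satisfying
Lemma 3.6 (3) with the same `p₁, S₂, β, κ` — in particular `b` itself — has `2|b′_i| < Q` for all `i`
(`|b′_i| ≤ ‖b′‖₂`). [cite: ChenQuantumLattice2024, §3.3 pp. 18–20 (Cond. C.1, C.2, C.3), Lemma 3.6 p. 17, eq. (12) p. 17; census §27.5 (i), §36] -/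
theorem two_mul_natAbs_lt_of_conditions {n : ℕ} (b b' : Fin (n + 1) → ℤ) (Q : ℕ+)
    {L D u t M N p₁ S₂ β κ : ℝ} (hL : 1 ≤ L) (hD : 0 < D) (hu : 0 < u) (hp : 0 < p₁)
    (hβ : 2 ≤ β) (hS₂ : 0 ≤ S₂) (hκ : 2 * κ ≤ (n + 1 : ℝ))
    (hC1 : 64 * L ^ 3 < t / u) (hC2u : u = D * Real.sqrt (∑ i, ((b i : ℤ) : ℝ) ^ 2))
    (hC2M : M = 2 * (t ^ 2 + u ^ 2)) (hC3 : M / (2 * D ^ 2) = N)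
    (hC3' : N = p₁ * (((Q : ℕ+) : ℕ) : ℝ))
    (h36 : ∃ θ : ℝ, 0.04 ≤ θ ∧ θ ≤ 0.27 ∧ (∑ i, ((b i : ℤ) : ℝ) ^ 2) =
      1 + 4 * p₁ ^ 2 * S₂ + θ * (4 * p₁ ^ 2 * β ^ 2 * ((n + 1 : ℝ) - κ)))
    (h36' : ∃ θ' : ℝ, 0.04 ≤ θ' ∧ θ' ≤ 0.27 ∧ (∑ i, ((b' i : ℤ) : ℝ) ^ 2) =
      1 + 4 * p₁ ^ 2 * S₂ + θ' * (4 * p₁ ^ 2 * β ^ 2 * ((n + 1 : ℝ) - κ))) :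
    ∀ i, 2 * (b' i).natAbs < ((Q : ℕ+) : ℕ) := by
  set normb : ℝ := Real.sqrt (∑ i, ((b i : ℤ) : ℝ) ^ 2) with hnormb_def
  set normb' : ℝ := Real.sqrt (∑ i, ((b' i : ℤ) : ℝ) ^ 2) with hnormb'_def
  have hsum : 0 ≤ ∑ i, ((b i : ℤ) : ℝ) ^ 2 := Finset.sum_nonneg fun i _ => sq_nonneg _
  have hsum' : 0 ≤ ∑ i, ((b' i : ℤ) : ℝ) ^ 2 := Finset.sum_nonneg fun i _ => sq_nonneg _
  have hnb2 : normb ^ 2 = ∑ i, ((b i : ℤ) : ℝ) ^ 2 := Real.sq_sqrt hsum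
  have hnb2' : normb' ^ 2 = ∑ i, ((b' i : ℤ) : ℝ) ^ 2 := Real.sq_sqrt hsum'
  have h36n : ∃ θ : ℝ, 0.04 ≤ θ ∧ θ ≤ 0.27 ∧
      normb ^ 2 = 1 + 4 * p₁ ^ 2 * S₂ + θ * (4 * p₁ ^ 2 * β ^ 2 * ((n + 1 : ℝ) - κ)) := by
    rw [hnb2]; exact h36
  have h36n' : ∃ θ' : ℝ, 0.04 ≤ θ' ∧ θ' ≤ 0.27 ∧
      normb' ^ 2 = 1 + 4 * p₁ ^ 2 * S₂ + θ' * (4 * p₁ ^ 2 * β ^ 2 * ((n + 1 : ℝ) - κ)) := by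
    rw [hnb2']; exact h36'
  have hQ := two_mul_norm_lt_of_conditions hL hD hu hp hβ hS₂ hκ (Real.sqrt_nonneg _)
    hC1 hC2u hC2M hC3 hC3' h36n h36n'
  intro i
  have hi : |((b' i : ℤ) : ℝ)| ≤ normb' :=
    Real.abs_le_sqrt (Finset.single_le_sum (f := fun j => ((b' j : ℤ) : ℝ) ^ 2)
      (fun j _ => sq_nonneg _) (Finset.mem_univ i))
  have h : ((2 * (b' i).natAbs : ℕ) : ℝ) < ((((Q : ℕ+) : ℕ) : ℕ) : ℝ) := by
    push_cast
    rw [Nat.cast_natAbs, Int.cast_abs]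
    linarith
  exact_mod_cast h

/-- **The hypothesis list of item 2 is satisfiable** (guard against vacuity), by the toy witness of
T27 (`regime_hypotheses_satisfiable`: `n + 1 = 1`, `b = b′ = (2)`, `L = D = p₁ = 1`, `u = 2`, `t = 130`,
`N = Q = 16904`, `β = 2`, `S₂ = κ = 0`, `θ = θ′ = 3/16` — NOT Chen's sizes, a consistency witness only for
the transcription of the printed conditions).
[cite: ChenQuantumLattice2024, §3.3 pp. 18–20 (Cond. C.1, C.2, C.3), Lemma 3.6 p. 17; census §36] -/
theorem classIsSecret_hypotheses_satisfiable :
    ∃ (b b' : Fin (0 + 1) → ℤ) (L D u t M N p₁ Q S₂ β κ : ℝ),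
      1 ≤ L ∧ 0 < D ∧ 0 < u ∧ 0 < p₁ ∧ 2 ≤ β ∧ 0 ≤ S₂ ∧ 2 * κ ≤ ((0 : ℕ) + 1 : ℝ) ∧
      64 * L ^ 3 < t / u ∧ u = D * Real.sqrt (∑ i, ((b i : ℤ) : ℝ) ^ 2) ∧
      M = 2 * (t ^ 2 + u ^ 2) ∧ M / (2 * D ^ 2) = N ∧ N = p₁ * Q ∧
      (∃ θ : ℝ, 0.04 ≤ θ ∧ θ ≤ 0.27 ∧ (∑ i, ((b i : ℤ) : ℝ) ^ 2) =
        1 + 4 * p₁ ^ 2 * S₂ + θ * (4 * p₁ ^ 2 * β ^ 2 * (((0 : ℕ) + 1 : ℝ) - κ))) ∧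
      (∃ θ' : ℝ, 0.04 ≤ θ' ∧ θ' ≤ 0.27 ∧ (∑ i, ((b' i : ℤ) : ℝ) ^ 2) =
        1 + 4 * p₁ ^ 2 * S₂ + θ' * (4 * p₁ ^ 2 * β ^ 2 * (((0 : ℕ) + 1 : ℝ) - κ))) := by
  obtain ⟨b, L, D, u, t, -, -, M, N, p₁, Q, S₂, β, κ, hL, hD, hu, -, hp, -, hβ, hS₂, hκ, hC1, hC2u,
    hC2M, hC3, hC3', -, -, h36⟩ := regime_hypotheses_satisfiable
  exact ⟨b, b, L, D, u, t, M, N, p₁, Q, S₂, β, κ, hL, by linarith, hu, by linarith, hβ, hS₂, hκ, hC1,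
    hC2u, hC2M, hC3, hC3', h36, h36⟩

end Sizes

/-! ### 3. The equality forms of T18 (4): a datum-certain measurement names the secret -/

section ClassIsSecret

variable (n : ℕ) (D p₁ Q : ℕ+) (b : Fin (n + 1) → ℤ)

/-- **T18 (4c) at Chen's sizes (census §27.5 (ii)).**  For head-`(−1)` directions `b, b′` all of whose
coordinates satisfy `2|·| < Q`, the datum reader of `b` is datum-certain on every line ket of `b′`
iff `b = b′` (not merely `b ≡ b′ (mod Q)`).
[cite: ChenQuantumLattice2024, §3.5.9 pp. 35–37, eq. (12) p. 17; census §27.5 (ii), §36] -/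
theorem datumReader_certain_iff_eq (hP : Odd ((p₁ * Q : ℕ+) : ℕ)) (hb : b 0 = -1)
    (b' : Fin (n + 1) → ℤ) (hb' : b' 0 = -1) (hunit : IsUnit ((2 * D * D * p₁ : ℕ) : ZQ Q))
    (hsm : ∀ k, 2 * (b k).natAbs < ((Q : ℕ+) : ℕ)) (hsm' : ∀ k, 2 * (b' k).natAbs < ((Q : ℕ+) : ℕ)) :
    (∀ w' : Fin (n + 1) → ℤ, (datumReader n D p₁ Q b hP hb).Certain (phi8bKet n D p₁ Q b' w')
        (toDatum D p₁ Q ((w' 0 : ℤ) : ZN D p₁ Q))) ↔ b = b' := by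
  rw [datumReader_certain_iff n D p₁ Q b hP hb b' hb' hunit]
  exact ⟨fun h => eq_of_forall_intCast_eq hsm hsm' h, fun h k => by rw [h]⟩

/-- **A datum-certain measurement names its direction (census §27.5 (ii)).**  If a measurement `E`
(any POVM on the Step-9 register with outcomes in `ℤ_Q`) is datum-certain on all line kets of `b` and
on all line kets of `b′` — two head-`(−1)` directions with all coordinates `2|·| < Q` — then `b = b′`:
equivalently, no measurement is datum-certain for two distinct such directions.
[cite: ChenQuantumLattice2024, §3.5.9 pp. 35–37, eq. (12) p. 17; NielsenChuang2010, Box 2.3 p. 87; census §27.5 (ii), §36] -/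
theorem eq_of_certain_both (hP : Odd ((p₁ * Q : ℕ+) : ℕ)) (hb : b 0 = -1)
    (b' : Fin (n + 1) → ℤ) (hb' : b' 0 = -1) (hunit : IsUnit ((2 * D * D * p₁ : ℕ) : ZQ Q))
    (hsm : ∀ k, 2 * (b k).natAbs < ((Q : ℕ+) : ℕ)) (hsm' : ∀ k, 2 * (b' k).natAbs < ((Q : ℕ+) : ℕ))
    (E : POVM (Fin (n + 1) → ZN D p₁ Q) (ZQ Q))
    (h₁ : ∀ v' : Fin (n + 1) → ℤ,
      E.Certain (phi8bKet n D p₁ Q b v') (toDatum D p₁ Q ((v' 0 : ℤ) : ZN D p₁ Q)))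
    (h₂ : ∀ w' : Fin (n + 1) → ℤ,
      E.Certain (phi8bKet n D p₁ Q b' w') (toDatum D p₁ Q ((w' 0 : ℤ) : ZN D p₁ Q))) :
    b = b' := by
  by_contra hne
  obtain ⟨i, hi⟩ := exists_intCast_ne_of_ne hsm hsm' hne
  exact not_certain_both n D p₁ Q b hP hb b' hb' hunit hi E ⟨h₁, h₂⟩

/-- **Assembled from the printed conditions (census §27.5 (i) + (ii)).**  For the planted vector `b`
of an instance satisfying C.1–C.3 (with `log n ≥ 1`) and Lemma 3.6 (3), and any rival head-`(−1)`
vector `b′` satisfying Lemma 3.6 (3) with the same `p₁, S₂, β, κ`: a measurement that is datum-certain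
on all line kets of `b` and of `b′` forces `b = b′` — at Chen's sizes a datum-certain Step-9
measurement determines the planted vector of eq. (12), i.e. the LWE secret and error, outright.  (The
real parameters `D′, p′` of the transcribed conditions are not identified with the register's `D, p₁`;
only `Q` is shared, through C.3 — identifying them would be a special case.)
[cite: ChenQuantumLattice2024, §3.3 pp. 18–20 (Cond. C.1, C.2, C.3), Lemma 3.6 p. 17, eq. (12) p. 17, §3.5.9 pp. 35–37; census §27.5, §36] -/
theorem eq_of_certain_both_of_conditions (hP : Odd ((p₁ * Q : ℕ+) : ℕ)) (hb : b 0 = -1)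
    (b' : Fin (n + 1) → ℤ) (hb' : b' 0 = -1) (hunit : IsUnit ((2 * D * D * p₁ : ℕ) : ZQ Q))
    {L D' u t M N p' S₂ β κ : ℝ} (hL : 1 ≤ L) (hD : 0 < D') (hu : 0 < u) (hp : 0 < p')
    (hβ : 2 ≤ β) (hS₂ : 0 ≤ S₂) (hκ : 2 * κ ≤ (n + 1 : ℝ))
    (hC1 : 64 * L ^ 3 < t / u) (hC2u : u = D' * Real.sqrt (∑ i, ((b i : ℤ) : ℝ) ^ 2))
    (hC2M : M = 2 * (t ^ 2 + u ^ 2)) (hC3 : M / (2 * D' ^ 2) = N)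
    (hC3' : N = p' * (((Q : ℕ+) : ℕ) : ℝ))
    (h36 : ∃ θ : ℝ, 0.04 ≤ θ ∧ θ ≤ 0.27 ∧ (∑ i, ((b i : ℤ) : ℝ) ^ 2) =
      1 + 4 * p' ^ 2 * S₂ + θ * (4 * p' ^ 2 * β ^ 2 * ((n + 1 : ℝ) - κ)))
    (h36' : ∃ θ' : ℝ, 0.04 ≤ θ' ∧ θ' ≤ 0.27 ∧ (∑ i, ((b' i : ℤ) : ℝ) ^ 2) =
      1 + 4 * p' ^ 2 * S₂ + θ' * (4 * p' ^ 2 * β ^ 2 * ((n + 1 : ℝ) - κ)))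
    (E : POVM (Fin (n + 1) → ZN D p₁ Q) (ZQ Q))
    (h₁ : ∀ v' : Fin (n + 1) → ℤ,
      E.Certain (phi8bKet n D p₁ Q b v') (toDatum D p₁ Q ((v' 0 : ℤ) : ZN D p₁ Q)))
    (h₂ : ∀ w' : Fin (n + 1) → ℤ,
      E.Certain (phi8bKet n D p₁ Q b' w') (toDatum D p₁ Q ((w' 0 : ℤ) : ZN D p₁ Q))) :
    b = b' :=
  eq_of_certain_both n D p₁ Q b hP hb b' hb' hunit
    (two_mul_natAbs_lt_of_conditions b b Q hL hD hu hp hβ hS₂ hκ hC1 hC2u hC2M hC3 hC3' h36 h36)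
    (two_mul_natAbs_lt_of_conditions b b' Q hL hD hu hp hβ hS₂ hκ hC1 hC2u hC2M hC3 hC3' h36 h36')
    E h₁ h₂

end ClassIsSecret

end Literature.Computability.Cryptography.Chen2024

/-! ### 4. For admissible shapes -/

namespace Literature.Computability.Cryptography.Chen2024.Shape

open Literature.Computability.Cryptography.Chen2024

variable (S : Shape)

/-- **T28 for admissible shapes.**  If all coordinates of `S.b` and of a head-`(−1)` direction `b′`
satisfy `2|·| < Q`, the datum reader of `S.b` is datum-certain on all line kets of `b′` iff `b′ = S.b`.
[cite: ChenQuantumLattice2024, §3.5.9 pp. 35–37, eq. (12) p. 17; census §27.5 (ii), §36] -/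
theorem datumReader_certain_iff_eq (h : S.Admissible) (hsm : ∀ k, 2 * (S.b k).natAbs < (S.Q : ℕ))
    {b' : Fin (S.n + 1) → ℤ} (hb' : b' 0 = -1) (hsm' : ∀ k, 2 * (b' k).natAbs < (S.Q : ℕ)) :
    (∀ w' : Fin (S.n + 1) → ℤ,
        (Chen2024.datumReader S.n S.D S.p₁ S.Q S.b h.odd_P h.b_head).Certain
          (phi8bKet S.n S.D S.p₁ S.Q b' w') (toDatum S.D S.p₁ S.Q ((w' 0 : ℤ) : ZN S.D S.p₁ S.Q)))
      ↔ S.b = b' :=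
  Chen2024.datumReader_certain_iff_eq S.n S.D S.p₁ S.Q S.b h.odd_P h.b_head b' hb'
    h.isUnit_twoDDp₁_modQ hsm hsm'

/-- **T28 for admissible shapes: a datum-certain measurement names the secret.**  If a measurement is
datum-certain on all line kets of `S.b` and of a head-`(−1)` direction `b′`, all coordinates of both
being `2|·| < Q`, then `b′ = S.b`.
[cite: ChenQuantumLattice2024, §3.5.9 pp. 35–37, eq. (12) p. 17; NielsenChuang2010, Box 2.3 p. 87; census §27.5 (ii), §36] -/
theorem eq_of_certain_both (h : S.Admissible) (hsm : ∀ k, 2 * (S.b k).natAbs < (S.Q : ℕ))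
    {b' : Fin (S.n + 1) → ℤ} (hb' : b' 0 = -1) (hsm' : ∀ k, 2 * (b' k).natAbs < (S.Q : ℕ))
    (E : POVM (Fin (S.n + 1) → ZN S.D S.p₁ S.Q) (ZQ S.Q))
    (h₁ : ∀ v' : Fin (S.n + 1) → ℤ,
      E.Certain (phi8bKet S.n S.D S.p₁ S.Q S.b v') (toDatum S.D S.p₁ S.Q ((v' 0 : ℤ) : ZN S.D S.p₁ S.Q)))
    (h₂ : ∀ w' : Fin (S.n + 1) → ℤ,
      E.Certain (phi8bKet S.n S.D S.p₁ S.Q b' w') (toDatum S.D S.p₁ S.Q ((w' 0 : ℤ) : ZN S.D S.p₁ S.Q))) :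
    S.b = b' :=
  Chen2024.eq_of_certain_both S.n S.D S.p₁ S.Q S.b h.odd_P h.b_head b' hb' h.isUnit_twoDDp₁_modQ
    hsm hsm' E h₁ h₂

end Literature.Computability.Cryptography.Chen2024.Shape
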